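import Summits.CriticalPhenomena.PercolationContinuityZ3.Theorems.Transplant.SqShadowGlueEvents
import Literature.Probability.Percolation.SlabGluing
import HarnessLib

/-!
# SQUARE SHADOWS XIII — Fact 1 of DST §2.3 in square geometry, I: the crossing step (a path of `B^±` meets a column of `γ_min`) and the closing map `Φ`

builds on p205010 (kernel theorem, internal audit signed; external expert review pending) — NOT used in this file.
Lane `prim-bschramm`, seat `prim-bschramm-p2` (gen 42; class C1b; memo `HOME/bschramm/P2-LATTICES.md` §148); helper file
(`--supports stmt-CriticalPhenomena-4575 --as helper`).  Hexagonal twin «HexShadowFact1Crossing» (there via the ×2 subdivision embedding of `𝕋`; here the shadow walks ARE `ℤ²`-walks, so the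
tree's planar crossing fact `exists_mem_support_of_side_crossing` of `Literature/…/SlabGluing` applies directly); slab original `Literature/…/SlabGluingFact1` §"Crossing"/"Closing".
* §1 `evC_of_mem_γmin_of_joined/src'`; the shadow walk of an open chain (`exists_walk_of_chain`), walks inside a square (`exists_walk_in_sqBall`); **`exists_mem_γcols`** — for `ω ∈ 𝒳`
  (a lattice configuration) and open self-avoiding paths `π⁻ : \overline{src'} → \overline{Y⁻}`, `π⁺ : \overline{src'} → \overline{Y⁺}` inside `\overline{small}` (in a sub-configuration),
  one of them has a vertex on a column of `γ_min(ω)`;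
* §2 **`exists_closed_edge`**, the closing map **`phi1 ω = ω ∖ closeSet ω`**, `γmin_phi1`, `U_phi1`, **`phi1_not_mem`** (`Φω ∉ B⁻ ∩ B⁺`), `diff_phi1_subset`.
[cite: DuminilCopinSidoraviciusTassion2016, §2.3 (proof of Fact 1, p. 6)]
-/

noncomputable section

namespace Summit.CriticalPhenomena.PercolationContinuityZ3.Theorems.Transplant

open MeasureTheory Literature.Probability.Percolation Literature.Probability.LatticeModels SimpleGraph Filter
open scoped Classical Topology

namespace SqShadow

variable {V : Type} {G : SimpleGraph V} (Ψ : SqShadow G) [Countable V]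

/-! ## §1 The crossing step -/

/-- `Y⁻ = sqSide c' m (−m) (−a)`. [cite: DuminilCopinSidoraviciusTassion2016, §2.1 (p. 5)] -/
def ym (D : GlueData) : Set (Site 2) := sqSide (Ψ.glueCentre D.m D.s) D.m (-(D.m : ℤ)) (-(D.a : ℤ))

/-- `Y⁺ = sqSide c' m a m`. [cite: DuminilCopinSidoraviciusTassion2016, §2.1 (p. 5)] -/
def yp (D : GlueData) : Set (Site 2) := sqSide (Ψ.glueCentre D.m D.s) D.m D.a D.m

omit [Countable V] in
/-- `B⁻` is the crossing `src' ⟷^{small} Y⁻`. [folklore] -/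
theorem glueBm_eq (D : GlueData) : Ψ.glueBm D.m D.u₁ D.a D.s = Ψ.conn (Ψ.small D) (Ψ.src' D) (Ψ.ym D) := rfl

omit [Countable V] in
/-- `B⁺` is the crossing `src' ⟷^{small} Y⁺`. [folklore] -/
theorem glueBp_eq (D : GlueData) : Ψ.glueBp D.m D.u₁ D.a D.s = Ψ.conn (Ψ.small D) (Ψ.src' D) (Ψ.yp D) := rfl

/-- A vertex of `γ_min` joined inside `\overline{small}` to `\overline{src'}` gives `C`. [folklore] -/
theorem evC_of_mem_γmin_of_joined (D : GlueData) {ω : BondConfig V} (hA : ω ∈ Ψ.glueA D.m D.u₃ D.a D.s) {v : V} (hv : v ∈ Ψ.γmin D ω) {s' : V}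
    (hs' : s' ∈ Ψ.lift (Ψ.src' D)) (hj : ω ∈ openConnIn (Ψ.lift (Ψ.small D)) v s') : ω ∈ Ψ.glueC D.m D.u₃ D.u₁ D.s := by
  have hγ := (Ψ.γmin_spec D hA).1
  refine ⟨(Ψ.γmin D ω).head hγ.ne_nil, hγ.head_mem _, s', hs', ?_⟩
  exact SlabCriticality.openConnIn_trans (openConnIn_mono (Ψ.lift_mono Set.subset_union_left) _ _ (hγ.openConnIn_of_mem hv))
    (openConnIn_mono (Ψ.lift_mono Set.subset_union_right) _ _ hj)

/-- A vertex of `γ_min` over `src'` gives `C`. [folklore] -/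
theorem evC_of_mem_γmin_of_src' (D : GlueData) {ω : BondConfig V} (hA : ω ∈ Ψ.glueA D.m D.u₃ D.a D.s) {v : V} (hv : v ∈ Ψ.γmin D ω)
    (hv' : v ∈ Ψ.lift (Ψ.src' D)) : ω ∈ Ψ.glueC D.m D.u₃ D.u₁ D.s := by
  have hγ := (Ψ.γmin_spec D hA).1
  refine ⟨(Ψ.γmin D ω).head hγ.ne_nil, hγ.head_mem _, v, hv', ?_⟩
  exact openConnIn_mono (Ψ.lift_mono Set.subset_union_left) _ _ (hγ.openConnIn_of_mem hv)

omit [Countable V] in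
/-- **The shadow of an open path is a lattice walk of `ℤ²`** (steps inside a column are dropped): for a lattice configuration `ω` and a chain `a :: l` of `ω`-open edges there is a
`zdGraph 2`-walk from `sh a` to the shadow of the last vertex all of whose vertices are shadows of vertices of the chain. [folklore] -/
theorem exists_walk_of_chain {ω : BondConfig V} (hω : ω ⊆ G.edgeSet) :
    ∀ (a : V) (l : List V), (a :: l).IsChain (fun a b => s(a, b) ∈ ω ∧ a ≠ b) →
      ∃ (e : V) (W : (zdGraph 2).Walk (Ψ.sh a) (Ψ.sh e)), (a :: l).getLast (List.cons_ne_nil a l) = e ∧ ∀ x ∈ W.support, ∃ v ∈ a :: l, Ψ.sh v = x := by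
  intro a l
  induction l generalizing a with
  | nil =>
    intro _
    refine ⟨a, Walk.nil, rfl, fun x hx => ⟨a, by simp, ?_⟩⟩
    rw [Walk.support_nil, List.mem_singleton] at hx
    exact hx.symm
  | cons b l ih =>
    intro hc
    rw [List.isChain_cons_cons] at hc
    obtain ⟨e, W, he, hW⟩ := ih b hc.2
    have hadj : G.Adj a b := (SimpleGraph.mem_edgeSet _).1 (hω hc.1.1)
    have hlast : (a :: b :: l).getLast (List.cons_ne_nil a (b :: l)) = e := by
      rw [List.getLast_cons (List.cons_ne_nil b l)]; exact he
    rcases Ψ.lip hadj with hpe | hpa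
    · refine ⟨e, W.copy hpe.symm rfl, hlast, fun x hx => ?_⟩
      rw [Walk.support_copy] at hx
      obtain ⟨v, hv, rfl⟩ := hW x hx
      exact ⟨v, by simp [hv], rfl⟩
    · refine ⟨e, Walk.cons hpa W, hlast, fun x hx => ?_⟩
      rw [Walk.support_cons, List.mem_cons] at hx
      rcases hx with rfl | hx
      · exact ⟨a, by simp, rfl⟩
      · obtain ⟨v, hv, rfl⟩ := hW x hx
        exact ⟨v, by simp [hv], rfl⟩

omit [Countable V] in
/-- A walk of `ℤ²` between two points of a square, inside the square (along a row, then a column). [folklore] -/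
theorem exists_walk_in_sqBall {c : Site 2} {m : ℕ} {z w : Site 2} (hz : z ∈ sqBall c m) (hw : w ∈ sqBall c m) :
    ∃ W : (zdGraph 2).Walk z w, ∀ x ∈ W.support, x ∈ sqBall c m := by
  rw [mem_sqBall_iff_linear] at hz hw
  set mid : Site 2 := ![w 0, z 1] with hmid
  have hm0 : mid 0 = w 0 := by simp [hmid]
  have hm1 : mid 1 = z 1 := by simp [hmid]
  have hH : ∃ H : (zdGraph 2).Walk z mid, ∀ x ∈ H.support, x 1 = z 1 ∧ min (z 0) (w 0) ≤ x 0 ∧ x 0 ≤ max (z 0) (w 0) := by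
    rcases le_total (z 0) (w 0) with h | h
    · obtain ⟨H, hH⟩ := exists_walk_horizontal (z := z) (w := mid) hm1.symm (by rw [hm0]; exact h)
      exact ⟨H, fun x hx => by have := hH x hx; rw [hm0] at this; omega⟩
    · obtain ⟨H, hH⟩ := exists_walk_horizontal (z := mid) (w := z) hm1 (by rw [hm0]; exact h)
      refine ⟨H.reverse, fun x hx => ?_⟩
      rw [Walk.support_reverse, List.mem_reverse] at hx
      have := hH x hx; rw [hm0, hm1] at this; omega
  have hV : ∃ H : (zdGraph 2).Walk mid w, ∀ x ∈ H.support, x 0 = w 0 ∧ min (z 1) (w 1) ≤ x 1 ∧ x 1 ≤ max (z 1) (w 1) := by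
    rcases le_total (z 1) (w 1) with h | h
    · obtain ⟨H, hH⟩ := exists_walk_vertical (z := mid) (w := w) hm0 (by rw [hm1]; exact h)
      exact ⟨H, fun x hx => by have := hH x hx; rw [hm0, hm1] at this; omega⟩
    · obtain ⟨H, hH⟩ := exists_walk_vertical (z := w) (w := mid) hm0.symm (by rw [hm1]; exact h)
      refine ⟨H.reverse, fun x hx => ?_⟩
      rw [Walk.support_reverse, List.mem_reverse] at hx
      have := hH x hx; rw [hm1] at this; omega
  obtain ⟨H₁, hH₁⟩ := hH
  obtain ⟨H₂, hH₂⟩ := hV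
  refine ⟨H₁.append H₂, fun x hx => ?_⟩
  rw [Walk.mem_support_append_iff] at hx
  rw [mem_sqBall_iff_linear]
  rcases hx with hx | hx
  · have := hH₁ x hx
    rw [min_le_iff, le_max_iff] at this; omega
  · have := hH₂ x hx
    rw [min_le_iff, le_max_iff] at this; omega

/-- **THE CROSSING STEP** (DST §2.3, proof of Fact 1: "two paths from `S̄'_n` to `Ȳ_n^-` and `Ȳ_n^+` respectively must intersect at least one set of the form `\overline{\{z\}}`
with `z` in `U(ω)`" — its first half): for `ω ∈ 𝒳` a lattice configuration (data in range) and open self-avoiding paths `π⁻`, `π⁺` from `\overline{src'}` to `\overline{Y⁻}`, `\overline{Y⁺}`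
inside `\overline{small}` in a sub-configuration `ω' ⊆ ω`, one of them has a vertex on a column of `γ_min(ω)`: else the shadow walks of `γ_min` (in `{x₀ ≤ c'₀ + m}` from
`{x₀ ≤ c'₀ − m}` to the right side line of `small`) and of `π⁻ ∪ link ∪ π⁺` (inside `small`, between `Y⁻` and `Y⁺`) would be disjoint, contradicting `exists_mem_support_of_side_crossing`.
[cite: DuminilCopinSidoraviciusTassion2016, §2.3 (proof of Fact 1)] -/
theorem exists_mem_γcols (D : GlueData) (hD : Ψ.InRange D) {ω ω' : BondConfig V} (hω : ω ⊆ G.edgeSet) (hω' : ω' ⊆ ω) (hX : ω ∈ Ψ.evX D)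
    {πm πp : List V} (hπm : OpenSAP ω' (Ψ.lift (Ψ.small D)) (Ψ.lift (Ψ.src' D)) (Ψ.lift (Ψ.ym D)) πm)
    (hπp : OpenSAP ω' (Ψ.lift (Ψ.small D)) (Ψ.lift (Ψ.src' D)) (Ψ.lift (Ψ.yp D)) πp) :
    ∃ x, (x ∈ πm ∨ x ∈ πp) ∧ Ψ.sh x ∈ Ψ.γcols D ω := by
  obtain ⟨-, hu₃, hu₁, ha1, ham, -, -⟩ := hD
  obtain ⟨⟨⟨hA, -⟩, -⟩, hC⟩ := hX
  have hγ := (Ψ.γmin_spec D hA).1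
  obtain ⟨a, lγ, haγ⟩ := List.exists_cons_of_ne_nil hγ.ne_nil
  obtain ⟨am0, lm, ham0⟩ := List.exists_cons_of_ne_nil hπm.ne_nil
  obtain ⟨ap0, lp, hap0⟩ := List.exists_cons_of_ne_nil hπp.ne_nil
  have hγ' : OpenSAP ω (Ψ.lift (Ψ.big D)) (Ψ.lift (Ψ.src D)) (Ψ.lift (Ψ.zSeg D)) (a :: lγ) := haγ ▸ hγ
  have hπm' := ham0 ▸ hπm
  have hπp' := hap0 ▸ hπp
  by_contra H
  push Not at H
  have hω'E : ω' ⊆ G.edgeSet := hω'.trans hω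
  obtain ⟨eγ, Wγ, heγ, hWγ⟩ := Ψ.exists_walk_of_chain hω a lγ hγ'.chain
  obtain ⟨em, Wm, hem, hWm⟩ := Ψ.exists_walk_of_chain hω'E am0 lm hπm'.chain
  obtain ⟨ep, Wp, hep, hWp⟩ := Ψ.exists_walk_of_chain hω'E ap0 lp hπp'.chain
  -- membership facts
  have hmemγ : ∀ v ∈ a :: lγ, v ∈ Ψ.γmin D ω := fun v hv => haγ ▸ hv
  have hmemm : ∀ v ∈ am0 :: lm, v ∈ πm := fun v hv => ham0 ▸ hv
  have hmemp : ∀ v ∈ ap0 :: lp, v ∈ πp := fun v hv => hap0 ▸ hv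
  have ha_src : a ∈ Ψ.lift (Ψ.src D) := hγ'.head_mem (List.cons_ne_nil _ _)
  have heγ_z : eγ ∈ Ψ.lift (Ψ.zSeg D) := by have := hγ'.last_mem (List.cons_ne_nil _ _); rwa [heγ] at this
  have heγ_mem : eγ ∈ Ψ.γmin D ω := hmemγ _ (heγ ▸ List.getLast_mem _)
  have ham0_src : am0 ∈ Ψ.lift (Ψ.src' D) := hπm'.head_mem (List.cons_ne_nil _ _)
  have hap0_src : ap0 ∈ Ψ.lift (Ψ.src' D) := hπp'.head_mem (List.cons_ne_nil _ _)
  have hem_y : em ∈ Ψ.lift (Ψ.ym D) := by have := hπm'.last_mem (List.cons_ne_nil _ _); rwa [hem] at this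
  have hep_y : ep ∈ Ψ.lift (Ψ.yp D) := by have := hπp'.last_mem (List.cons_ne_nil _ _); rwa [hep] at this
  have hem_mem : em ∈ πm := hmemm _ (hem ▸ List.getLast_mem _)
  have hep_mem : ep ∈ πp := hmemp _ (hep ▸ List.getLast_mem _)
  -- the link inside `src'` and the walk `Q`
  obtain ⟨Conn, hConn⟩ := exists_walk_in_sqBall (show Ψ.sh am0 ∈ sqBall (Ψ.glueCentre D.m D.s) D.u₁ from ham0_src)
    (show Ψ.sh ap0 ∈ sqBall (Ψ.glueCentre D.m D.s) D.u₁ from hap0_src)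
  let Q : (zdGraph 2).Walk (Ψ.sh em) (Ψ.sh ep) := Wm.reverse.append (Conn.append Wp)
  -- coordinates
  set c' := Ψ.glueCentre D.m D.s with hc'def
  have hc'0 : c' 0 = Ψ.centre 0 + 2 * D.m := by rw [hc'def]; exact (Ψ.glueCentre_apply D.m D.s).1
  have hbig : ∀ v ∈ Ψ.γmin D ω, Ψ.sh v 0 ≤ c' 0 + D.m := by
    intro v hv
    have h := hγ.subset v hv
    rw [mem_lift, big, mem_sqBall_iff_linear] at h
    push_cast at h; omega
  have hsmall : ∀ z : Site 2, z ∈ Ψ.small D → c' 0 - D.m ≤ z 0 ∧ z 0 ≤ c' 0 + D.m ∧ c' 1 - D.m ≤ z 1 ∧ z 1 ≤ c' 1 + D.m := by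
    intro z hz
    rw [small, mem_sqBall_iff_linear, ← hc'def] at hz
    exact hz
  have hsrc'_small : Ψ.src' D ⊆ Ψ.small D := sqBall_mono _ (by omega)
  have hγbd : ∀ x ∈ Wγ.support, x 0 ≤ c' 0 + D.m := by
    intro x hx
    obtain ⟨v, hv, rfl⟩ := hWγ x hx
    exact hbig v (hmemγ v hv)
  have hQsupp : ∀ x ∈ Q.support, (∃ u, (u ∈ πm ∨ u ∈ πp) ∧ Ψ.sh u = x) ∨ x ∈ Ψ.src' D := by
    intro x hx
    rw [Walk.mem_support_append_iff, Walk.mem_support_append_iff, Walk.support_reverse, List.mem_reverse] at hx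
    rcases hx with hx | hx | hx
    · obtain ⟨u, hu, rfl⟩ := hWm x hx
      exact Or.inl ⟨u, Or.inl (hmemm u hu), rfl⟩
    · exact Or.inr (hConn x hx)
    · obtain ⟨u, hu, rfl⟩ := hWp x hx
      exact Or.inl ⟨u, Or.inr (hmemp u hu), rfl⟩
  have hπsmall : ∀ w, (w ∈ πm ∨ w ∈ πp) → Ψ.sh w ∈ Ψ.small D := by
    rintro w (hw | hw)
    · exact hπm.subset w hw
    · exact hπp.subset w hw
  have hQbd : ∀ x ∈ Q.support, c' 0 - D.m ≤ x 0 ∧ x 0 ≤ c' 0 + D.m ∧ c' 1 - D.m ≤ x 1 ∧ x 1 ≤ c' 1 + D.m := by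
    intro x hx
    rcases hQsupp x hx with ⟨u, hu, rfl⟩ | hx'
    · exact hsmall _ (hπsmall u hu)
    · exact hsmall _ (hsrc'_small hx')
  -- no vertex of `π^±` projects onto a column of `γ_min`, by assumption `H`
  have hoff : ∀ w, (w ∈ πm ∨ w ∈ πp) → ∀ v ∈ Ψ.γmin D ω, Ψ.sh v ≠ Ψ.sh w :=
    fun w hw v hv heq => H w hw ⟨v, hv, heq⟩
  -- the three marked points on the side line `{w₀ = c'₀ + m}`
  have heγ' : Ψ.sh eγ 0 = c' 0 + D.m ∧ -(D.a : ℤ) ≤ Ψ.sh eγ 1 - c' 1 ∧ Ψ.sh eγ 1 - c' 1 ≤ D.a := by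
    rw [mem_lift, zSeg, mem_sqSide] at heγ_z; exact heγ_z
  have hem' : Ψ.sh em 0 = c' 0 + D.m ∧ -(D.m : ℤ) ≤ Ψ.sh em 1 - c' 1 ∧ Ψ.sh em 1 - c' 1 ≤ -(D.a : ℤ) := by
    rw [mem_lift, ym, mem_sqSide] at hem_y; exact hem_y
  have hep' : Ψ.sh ep 0 = c' 0 + D.m ∧ (D.a : ℤ) ≤ Ψ.sh ep 1 - c' 1 ∧ Ψ.sh ep 1 - c' 1 ≤ D.m := by
    rw [mem_lift, yp, mem_sqSide] at hep_y; exact hep_y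
  have h1 : Ψ.sh em 1 < Ψ.sh eγ 1 := by
    rcases lt_or_eq_of_le (show Ψ.sh em 1 ≤ Ψ.sh eγ 1 by omega) with h | h
    · exact h
    · exact absurd (Site.eq_iff_two.2 ⟨by omega, h.symm⟩) (hoff em (Or.inl hem_mem) eγ heγ_mem)
  have h2 : Ψ.sh eγ 1 < Ψ.sh ep 1 := by
    rcases lt_or_eq_of_le (show Ψ.sh eγ 1 ≤ Ψ.sh ep 1 by omega) with h | h
    · exact h
    · exact absurd (Site.eq_iff_two.2 ⟨by omega, h⟩) (hoff ep (Or.inr hep_mem) eγ heγ_mem)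
  have hsa : Ψ.sh a 0 ≤ c' 0 - D.m := by
    rw [mem_lift, src, mem_sqBall_iff_linear] at ha_src
    omega
  obtain ⟨x, hxγ, hxQ⟩ := exists_mem_support_of_side_crossing (L := c' 0 - D.m) (R := c' 0 + D.m) (B := c' 1 - D.m) (T := c' 1 + D.m)
    Wγ Q hγbd hsa heγ'.1 hQbd hem'.1 hep'.1 h1 h2
  -- the common point is a common shadow point
  obtain ⟨v, hv, hvx⟩ := hWγ x hxγ
  rcases hQsupp x hxQ with ⟨u', hu', hu'x⟩ | hx_src'
  · exact hoff u' hu' v (hmemγ v hv) (hvx.trans hu'x.symm)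
  · exact hC (Ψ.evC_of_mem_γmin_of_src' D hA (hmemγ v hv) (by rw [mem_lift, hvx]; exact hx_src'))

/-! ## §2 The first crossing vertex and the closing map `Ψ` -/

/-- "`v` is joined to `\overline{src'}` inside `\overline{small}`". [cite: DuminilCopinSidoraviciusTassion2016, §2.3 (proof of Fact 1)] -/
def JoinedSrc' (D : GlueData) (ω : BondConfig V) (v : V) : Prop := ∃ s' ∈ Ψ.lift (Ψ.src' D), ω ∈ openConnIn (Ψ.lift (Ψ.small D)) v s'

/-- **The first crossing vertex** (DST §2.3, proof of Fact 1, second half): for `ω ∈ 𝒳` a lattice configuration and an open self-avoiding path `π` from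
`\overline{src'}` inside `\overline{small}` (in a sub-configuration `ω' ⊆ ω`) meeting a column of `γ_min(ω)`, the first vertex `x₁` of `π` on such a column and
its predecessor `x₀`: `s(x₀, x₁)` is `ω'`-open, the column of `x₁` is a point of `U(ω)` (witnessed by the initial segment of `π`), and `x₀` is joined to
`\overline{src'}` inside `\overline{small}`. [cite: DuminilCopinSidoraviciusTassion2016, §2.3 (proof of Fact 1)] -/
theorem exists_closed_edge (D : GlueData) {ω ω' : BondConfig V} (hω : ω ⊆ G.edgeSet) (hω' : ω' ⊆ ω) (hX : ω ∈ Ψ.evX D) {Y : Set V} {π : List V}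
    (hπ : OpenSAP ω' (Ψ.lift (Ψ.small D)) (Ψ.lift (Ψ.src' D)) Y π) (hmeet : ∃ x ∈ π, Ψ.sh x ∈ Ψ.γcols D ω) :
    ∃ x₀ x₁, s(x₀, x₁) ∈ ω' ∧ Ψ.sh x₁ ∈ Ψ.U D ω ∧ Ψ.JoinedSrc' D ω x₀ := by
  obtain ⟨⟨⟨hA, -⟩, -⟩, hC⟩ := hX
  obtain ⟨l₁, x₁, l₂, hsplit, hx₁, hl₁⟩ := exists_first_split π hmeet
  -- `l₁` is non-empty: the start of `π` lies over `src'`, and a column of `γ_min` over `src'` would give `C`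
  have hl₁ne : l₁ ≠ [] := by
    rintro rfl
    have hhead : x₁ ∈ Ψ.lift (Ψ.src' D) := by
      have := hπ.head_mem hπ.ne_nil
      simp only [hsplit, List.nil_append, List.head_cons] at this
      exact this
    obtain ⟨v, hv, hveq⟩ := hx₁
    exact hC (Ψ.evC_of_mem_γmin_of_src' D hA hv (by rw [mem_lift, hveq]; exact hhead))
  obtain ⟨b, l₁', hb⟩ := List.exists_cons_of_ne_nil hl₁ne
  set x₀ := l₁.getLast hl₁ne with hx₀
  have hx₀l₁ : x₀ ∈ l₁ := List.getLast_mem hl₁ne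
  have hchain := hπ.chain
  rw [hsplit, List.isChain_append] at hchain
  obtain ⟨hc₁, -, hlink⟩ := hchain
  have hR : s(x₀, x₁) ∈ ω' ∧ x₀ ≠ x₁ :=
    hlink x₀ (by rw [List.getLast?_eq_some_getLast hl₁ne, hx₀]; exact Option.mem_some_iff.2 rfl) x₁ (by simp)
  have hmemπ : ∀ v ∈ l₁, v ∈ π := fun v hv => by rw [hsplit]; exact List.mem_append_left _ hv
  have hx₁π : x₁ ∈ π := by rw [hsplit]; simp
  -- `x₀ x₁` is a lattice edge: the shadows are within sup-distance `1`
  have hadj : G.Adj x₀ x₁ := (SimpleGraph.mem_edgeSet _).1 (hω (hω' hR.1))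
  have hnear : Ψ.sh x₀ ∈ sqBall (Ψ.sh x₁) 1 := by
    rw [mem_sqBall, Nat.cast_one]; exact ⟨Ψ.abs_sh_sub_sh_le_one hadj 0, Ψ.abs_sh_sub_sh_le_one hadj 1⟩
  -- the initial segment joins `b ∈ \overline{src'}` to `x₀` off the columns of `γ_min`
  have hb_src : b ∈ Ψ.lift (Ψ.src' D) := by
    have := hπ.head_mem hπ.ne_nil
    simp only [hsplit, hb, List.cons_append, List.head_cons] at this
    exact this
  have hseg : ω' ∈ openConnIn (Ψ.lift (Ψ.small D) ∩ {v | Ψ.sh v ∉ Ψ.γcols D ω}) b x₀ := by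
    have hc₁' : (b :: l₁').IsChain (fun a c => s(a, c) ∈ ω' ∧ a ≠ c) := hb ▸ hc₁
    refine openConnIn_head_of_mem_chain b l₁' hc₁' (fun v hv => ?_) x₀ (hb ▸ hx₀l₁)
    have hv' : v ∈ l₁ := hb ▸ hv
    exact ⟨hπ.subset v (hmemπ v hv'), hl₁ v hv'⟩
  have hseg' : ω ∈ openConnIn (Ψ.lift (Ψ.small D) ∩ {v | Ψ.sh v ∉ Ψ.γcols D ω}) x₀ b := openConnIn_mono_config hω' (openConnIn_reverse hseg)
  refine ⟨x₀, x₁, hR.1, ⟨hπ.subset x₁ hx₁π, hx₁, x₀, hnear, b, hb_src, hseg'⟩, b, hb_src, openConnIn_mono Set.inter_subset_left _ _ hseg'⟩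

/-- **The set of edges closed by the map of Fact 1**: the open edges `s(u, v)` with `u` on a column of `U(ω)` and `v` joined to `\overline{src'}` inside
`\overline{small}`. [cite: DuminilCopinSidoraviciusTassion2016, §2.3 (proof of Fact 1)] -/
def closeSet (D : GlueData) (ω : BondConfig V) : Set (Sym2 V) := {e | e ∈ ω ∧ ∃ u v, e = s(u, v) ∧ Ψ.sh u ∈ Ψ.U D ω ∧ Ψ.JoinedSrc' D ω v}

/-- **The map `Φ` of Fact 1** (DST's notation): `ω ↦ ω ∖ closeSet ω`. [cite: DuminilCopinSidoraviciusTassion2016, §2.3 (proof of Fact 1, the map Ψ)] -/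
def phi1 (D : GlueData) (ω : BondConfig V) : BondConfig V := ω \ Ψ.closeSet D ω

/-- `Ψ(ω) ⊆ ω`. [folklore] -/
theorem phi1_subset (D : GlueData) (ω : BondConfig V) : Ψ.phi1 D ω ⊆ ω := Set.sdiff_subset

/-- On `𝒳`, no edge joining two vertices of `γ_min(ω)` is closed (its endpoint joined to `\overline{src'}` would give `C`).
[cite: DuminilCopinSidoraviciusTassion2016, §2.3 (proof of Fact 1)] -/
theorem not_mem_closeSet_of_mem_γmin (D : GlueData) {ω : BondConfig V} (hX : ω ∈ Ψ.evX D) {a b : V} (ha : a ∈ Ψ.γmin D ω) (hb : b ∈ Ψ.γmin D ω) :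
    s(a, b) ∉ Ψ.closeSet D ω := by
  obtain ⟨⟨⟨hA, -⟩, -⟩, hC⟩ := hX
  rintro ⟨-, u, v, heq, -, s', hs', hj⟩
  have hv : v ∈ Ψ.γmin D ω := by
    have : v ∈ s(a, b) := by rw [heq]; exact Sym2.mem_mk_right u v
    rcases Sym2.mem_iff.1 this with rfl | rfl
    · exact ha
    · exact hb
  exact hC (Ψ.evC_of_mem_γmin_of_joined D hA hv hs' hj)

/-- On `𝒳`, `γ_min(Ψ(ω)) = γ_min(ω)`. [cite: DuminilCopinSidoraviciusTassion2016, §2.3 (proof of Fact 1: γ_min(ω') = γ_min(ω))] -/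
theorem γmin_phi1 (D : GlueData) {ω : BondConfig V} (hX : ω ∈ Ψ.evX D) : Ψ.γmin D (Ψ.phi1 D ω) = Ψ.γmin D ω := by
  have hA : ω ∈ Ψ.glueA D.m D.u₃ D.a D.s := hX.1.1.1
  have hγ := (Ψ.γmin_spec D hA).1
  refine minSAP_eq_of_subset (Ψ.phi1_subset D ω) (Ψ.lift_big_finite D) ((mem_openCrossing_iff_exists_openSAP ω _ _ _).1 hA)
    (hγ.of_edges fun a ha b hb hab => ?_)
  exact ⟨hab, Ψ.not_mem_closeSet_of_mem_γmin D hX ha hb⟩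

/-- The edges off the columns of `γ_min` are untouched by `Ψ`. [folklore] -/
theorem mem_phi1_iff_of_off (D : GlueData) {ω : BondConfig V} {e : Sym2 V} (he : e ∈ (Ψ.lift (Ψ.small D) ∩ {v | Ψ.sh v ∉ Ψ.γcols D ω}).sym2) :
    e ∈ ω ↔ e ∈ Ψ.phi1 D ω := by
  refine ⟨fun h => ⟨h, ?_⟩, fun h => h.1⟩
  rintro ⟨-, u, v, rfl, hu, -⟩
  have hu' := (Set.mk_mem_sym2_iff.1 he).1
  exact hu'.2 (Ψ.U_subset_γcols D ω hu)

/-- On `𝒳`, `U(Ψ(ω)) = U(ω)`. [cite: DuminilCopinSidoraviciusTassion2016, §2.3 (proof of Fact 1: U(ω') = U(ω))] -/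
theorem U_phi1 (D : GlueData) {ω : BondConfig V} (hX : ω ∈ Ψ.evX D) : Ψ.U D (Ψ.phi1 D ω) = Ψ.U D ω := by
  have hcols : Ψ.γcols D (Ψ.phi1 D ω) = Ψ.γcols D ω := by simp only [γcols, Ψ.γmin_phi1 D hX]
  ext z
  simp only [U, Set.mem_setOf_eq, hcols]
  refine and_congr_right fun _ => and_congr_right fun _ => ?_
  refine exists_congr fun x₀ => and_congr_right fun _ => exists_congr fun s' => and_congr_right fun _ => ?_
  exact (openConnIn_congr (fun e he => Ψ.mem_phi1_iff_of_off D he) x₀ s').symm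

/-- **`Ψ` blocks `B⁻ ∩ B⁺`** (DST §2.3, proof of Fact 1: "`ω'` cannot contain two open paths in `B̄'_n` from `S̄'_n` to `Ȳ_n^-` and `Ȳ_n^+` respectively"):
for `ω ∈ 𝒳` a lattice configuration, data in range, `Ψ(ω) ∉ B⁻ ∩ B⁺`. [cite: DuminilCopinSidoraviciusTassion2016, §2.3 (proof of Fact 1)] -/
theorem phi1_not_mem (D : GlueData) (hD : Ψ.InRange D) {ω : BondConfig V} (hω : ω ⊆ G.edgeSet) (hX : ω ∈ Ψ.evX D) :
    Ψ.phi1 D ω ∉ Ψ.glueBm D.m D.u₁ D.a D.s ∩ Ψ.glueBp D.m D.u₁ D.a D.s := by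
  rintro ⟨hBm, hBp⟩
  rw [glueBm_eq] at hBm
  rw [glueBp_eq] at hBp
  obtain ⟨πm, hπm⟩ := (mem_openCrossing_iff_exists_openSAP _ _ _ _).1 hBm
  obtain ⟨πp, hπp⟩ := (mem_openCrossing_iff_exists_openSAP _ _ _ _).1 hBp
  obtain ⟨x, hx, hxcol⟩ := Ψ.exists_mem_γcols D hD hω (Ψ.phi1_subset D ω) hX hπm hπp
  have key : ∀ {Y : Set V} {π : List V}, OpenSAP (Ψ.phi1 D ω) (Ψ.lift (Ψ.small D)) (Ψ.lift (Ψ.src' D)) Y π →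
      (∃ x ∈ π, Ψ.sh x ∈ Ψ.γcols D ω) → False := by
    intro Y π hπ hmeet
    obtain ⟨x₀, x₁, hopen, hU, hj⟩ := Ψ.exists_closed_edge D hω (Ψ.phi1_subset D ω) hX hπ hmeet
    have hclosed : s(x₀, x₁) ∈ Ψ.closeSet D ω := ⟨hopen.1, x₁, x₀, Sym2.eq_swap, hU, hj⟩
    exact hopen.2 hclosed
  rcases hx with hx | hx
  · exact key hπm ⟨x, hx, hxcol⟩
  · exact key hπp ⟨x, hx, hxcol⟩

/-- The edges closed by `Ψ` sit at the columns of `U(Ψ(ω))`. [folklore] -/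
theorem diff_phi1_subset (D : GlueData) {ω : BondConfig V} (hX : ω ∈ Ψ.evX D) :
    ω \ Ψ.phi1 D ω ⊆ {e | ∃ u ∈ e, Ψ.sh u ∈ Ψ.U D (Ψ.phi1 D ω)} := by
  rintro e ⟨he, hne⟩
  have he' : e ∈ Ψ.closeSet D ω := by
    by_contra h
    exact hne ⟨he, h⟩
  obtain ⟨-, u, v, rfl, hu, -⟩ := he'
  exact ⟨u, Sym2.mem_mk_left u v, by rw [Ψ.U_phi1 D hX]; exact hu⟩

end SqShadow

end Summit.CriticalPhenomena.PercolationContinuityZ3.Theorems.Transplant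

end
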